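import Mathlib
import HarnessLib
import Summits.ValiantsHypothesis.ValiantsHypothesis.Theses.MonotoneRestoration
import Literature.Computability.AlgebraicComplexity.ArithCircuit
import Literature.Computability.AlgebraicComplexity.ArithCircuitProofs
import Literature.Computability.AlgebraicComplexity.MonotoneStructure
import Literature.Computability.AlgebraicComplexity.PermanentIrreducible
import Literature.ModelTheory.FiniteModelTheory.CkEquiv
import Summits.ValiantsHypothesis.ValiantsHypothesis.Theorems.MonotoneRestorationMonotoneRestorationQPCosetCount
import Summits.ValiantsHypothesis.ValiantsHypothesis.Theorems.MonotoneRestorationMonotoneRestorationQPSymmetricLB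
import Summits.ValiantsHypothesis.ValiantsHypothesis.Theorems.MonotoneRestorationMonotoneRestorationQPSupportSymmetrisation
import Summits.ValiantsHypothesis.ValiantsHypothesis.Theorems.MonotoneRestorationMonotoneRestorationQPSparseRegime
import Summits.ValiantsHypothesis.ValiantsHypothesis.Theorems.MonotoneRestorationMonotoneRestorationQPBeta
import Literature.Computability.AlgebraicComplexity.SymmetricArithCircuit
import Literature.Computability.AlgebraicComplexity.DawarWilsenach2025Proofs
import Literature.GroupTheory.PermutationGroups.SmallIndexSubgroups
import Summits.ValiantsHypothesis.ValiantsHypothesis.Theorems.MonotoneRestorationQP.Negative.LoadBearing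
import Summits.ValiantsHypothesis.ValiantsHypothesis.Theorems.MonotoneRestorationMonotoneRestorationQPPermSupportCount

/-! TTRL-lite variant V19927 of stmt-ValiantsHypothesis-15886 -/

set_option linter.dupNamespace false

namespace Summit.ValiantsHypothesis.ValiantsHypothesis.Theorems

open Summit.ValiantsHypothesis.ValiantsHypothesis.Theses.MonotoneRestoration
open Literature.Computability.AlgebraicComplexity

/-- TTRL-lite variant V19927 of the arithmetic stub `stub_gammaArithmetic` of
`stmt-ValiantsHypothesis-15886`: the ℕ-form of the reciprocal Bernoulli bound
`(1 + 1/m)^c ≤ m / (m - c)`, namely `(m+1)^c * (m - c) ≤ m^c * m` for all `c m : ℕ`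
(truncated subtraction).  Proof: induction on `c` with `m` fixed; writing `d := m - (c+1)` and
`P := (m+1)^c`, the step is `P (m+1) d = P m d + P d ≤ P m d + P m = m · (P (d+1)) ≤ m · (m^c · m)`. -/
theorem stub_gammaArithmetic_var19927 : ∀ (c m : ℕ), (m + 1) ^ c * (m - c) ≤ m ^ c * m := by
  intro c
  induction c with
  | zero => intro m; simp
  | succ c ih =>
    intro m
    rcases Nat.lt_or_ge c m with hmc | hmc
    swap
    · have h0 : m - (c + 1) = 0 := by omega
      rw [h0, mul_zero]
      exact Nat.zero_le _
    · have hX := ih m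
      have h1 : m - c = (m - (c + 1)) + 1 := by omega
      rw [h1] at hX
      have h2 : m - (c + 1) ≤ m := Nat.sub_le m (c + 1)
      set d := m - (c + 1)
      have e1 : m * ((m + 1) ^ c * (d + 1)) ≤ m * (m ^ c * m) := Nat.mul_le_mul_left m hX
      have e2 : (m + 1) ^ c * d ≤ (m + 1) ^ c * m := Nat.mul_le_mul_left _ h2
      calc (m + 1) ^ (c + 1) * d
          = (m + 1) ^ c * m * d + (m + 1) ^ c * d := by ring
        _ ≤ (m + 1) ^ c * m * d + (m + 1) ^ c * m := Nat.add_le_add_left e2 _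
        _ = m * ((m + 1) ^ c * (d + 1)) := by ring
        _ ≤ m * (m ^ c * m) := e1
        _ = m ^ (c + 1) * m := by ring

end Summit.ValiantsHypothesis.ValiantsHypothesis.Theorems
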